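import Summits.NavierStokesRegularity.NavierStokesRegularity.Theorems.CoreLogGasBlowupIsLocallyDrivenCoherenceReduction

/-!
# Crux `CoreLogGas.BlowupIsLocallyDriven` (stmt-NavierStokesRegularity-11291): the STRETCHING-DIRECTION re-typing
# (`B_rate2_xi`) — far-field reduction and reduction to direction coherence across the shell

`--supports stmt-NavierStokesRegularity-11291` (lead `prover-line-stmt-NavierStokesRegularity-11291-c5-0`, 2026-08-17).

Lead c3's variant of the re-typed crux bounds the exterior gradient only in the direction of the vorticity at the peak,
`w = ω(t,x)`, written division-free (`B_rate2_xi`, `Cruxes/BlowupIsLocallyDriven/RestatementC4.lean`; its text is the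
conclusion of the landed `Rate.bRateStretch_of_bRate`). Only `⟪D ξ, ξ⟫` amplifies `|ω|` at a maximum point, and by the
depletion files of this crux (`Depletion.shellStretch_*`) the shell vorticity stretches the peak along `ξ` only through
its component orthogonal to `ξ` — so the `ξ`-form is passed (with `C = 0`) by straight tubes, antiparallel pairs and
unidirectional layers through the peak, and what it excludes is direction-DISORDERED far vorticity (the radial
'hedgehog' pancake of Hou's scenario, swirling blobs). This file gives the `ξ`-form the same formal standing as the
all-directions form:

* `bRateXi_of_shellRateXi` (registered stub) — **far-field reduction in `ξ`-form**: `B_rate2_xi` follows from the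
  `ξ`-form of rate shell locality `ShellRateXi2` (`|⟪D_shell w, w⟫| ≤ (C/M²·Ω(t) + g₁(t))·‖w‖²`, `Mρ ≤ R`), by the
  landed unit-vector far-field bound `Registered.farFieldStrain` scaled by `‖w‖²`, the energy bound and
  `Registered.stub_enstrophyControl` (the `ξ`-analogue of `Rate.bRate_of_shellRate`);
* `shellRateXi_of_shellRate` — the all-directions shell statement implies the `ξ`-form;
* `shellRateXi_of_shellCoherenceXi` (registered stub) — **pointwise coherence relative to `ξ(t,x)` ⇒ `ShellRateXi2`**:
  `‖‖w‖²ω(t,y) − ⟪ω(t,y),w⟫w‖ ≤ c ρ² Ω(t) |x − y|⁻² ‖w‖²` across `B(x,R) ∖ B(x,Mρ)` (i.e. `|ω(t,y)| |sin∠(ω(t,y), ξ(t,x))|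
  ≤ c ρ² Ω(t)/|x − y|²`) gives `ShellRateXi2` with `g₁ = 0`;
* `shellRateXi_of_depletedShellRateXi` (registered stub) — the sharper integral form: a bound
  `(C/M²·Ω(t) + g₁(t))·‖w‖²` of the depleted shell integral `∫_shell ‖‖w‖²ω(t,y) − ⟪ω(t,y),w⟫w‖ |x − y|⁻³ dy` suffices;
* `bRateXi_of_shellCoherenceXi`, `bRateXi_of_depletedShellRateXi` — the compositions to `B_rate2_xi` verbatim.

References: P. Constantin, C. Fefferman, Indiana Univ. Math. J. 42 (1993), §2; P. Constantin, SIAM Review 36 (1994);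
T. Tao, arXiv:1108.1165 §10.
-/

noncomputable section

open Set MeasureTheory Filter Topology Metric
open scoped ContDiff

-- justification: the namespace is fixed by the crux protocol (sibling files of this crux use `…Theorems.BlowupIsLocallyDriven.*`).
set_option linter.dupNamespace false

namespace Summit.NavierStokesRegularity.NavierStokesRegularity.Theorems.BlowupIsLocallyDriven.Depletion

open Literature.Analysis.FluidPDE
open Summit.NavierStokesRegularity.NavierStokesRegularity.Theorems.BlowupIsLocallyDriven.Registered
open Summit.NavierStokesRegularity.NavierStokesRegularity.Theorems.BlowupIsLocallyDriven.Rate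

/-! ### Scaling between a unit vector and `w` -/

/-- A quadratic-form bound over unit vectors scales to every vector: `|⟪D w, w⟫| ≤ B ‖w‖²`. [folklore] -/
theorem abs_inner_apply_self_le_of_unit (D : EuclideanSpace ℝ (Fin 3) →L[ℝ] EuclideanSpace ℝ (Fin 3)) {B : ℝ}
    (h : ∀ e : EuclideanSpace ℝ (Fin 3), ‖e‖ = 1 → |inner ℝ (D e) e| ≤ B) (w : EuclideanSpace ℝ (Fin 3)) :
    |inner ℝ (D w) w| ≤ B * ‖w‖ ^ 2 := by
  by_cases hw0 : w = 0
  · simp [hw0]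
  · have hnw : 0 < ‖w‖ := norm_pos_iff.2 hw0
    obtain ⟨e, he⟩ : ∃ e : EuclideanSpace ℝ (Fin 3), e = ‖w‖⁻¹ • w := ⟨_, rfl⟩
    have hen : ‖e‖ = 1 := by
      rw [he, norm_smul, norm_inv, norm_norm, inv_mul_cancel₀ hnw.ne']
    have hwe : w = ‖w‖ • e := by
      rw [he, smul_smul, mul_inv_cancel₀ hnw.ne', one_smul]
    calc |inner ℝ (D w) w| = |inner ℝ (D (‖w‖ • e)) (‖w‖ • e)| := by rw [← hwe]
      _ = ‖w‖ ^ 2 * |inner ℝ (D e) e| := by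
          rw [inner_apply_smul_self, abs_mul, abs_of_nonneg (sq_nonneg _)]
      _ ≤ ‖w‖ ^ 2 * B := mul_le_mul_of_nonneg_left (h e hen) (sq_nonneg _)
      _ = B * ‖w‖ ^ 2 := mul_comm _ _

/-- The orthogonal component relative to the unit vector `‖w‖⁻¹ w`, division-free:
`a − ⟪a, e⟫e = (‖w‖²)⁻¹ (‖w‖² a − ⟪a, w⟫ w)`. [folklore] -/
theorem sub_inner_smul_unit_eq {w : EuclideanSpace ℝ (Fin 3)} (hw : w ≠ 0) (a : EuclideanSpace ℝ (Fin 3)) :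
    a - inner ℝ a (‖w‖⁻¹ • w) • (‖w‖⁻¹ • w) = (‖w‖ ^ 2)⁻¹ • (‖w‖ ^ 2 • a - inner ℝ a w • w) := by
  have hnw : ‖w‖ ≠ 0 := norm_ne_zero_iff.2 hw
  have h2 : (‖w‖ ^ 2)⁻¹ * ‖w‖ ^ 2 = 1 := inv_mul_cancel₀ (pow_ne_zero 2 hnw)
  rw [real_inner_smul_right, smul_smul, smul_sub, smul_smul, smul_smul, h2, one_smul]
  have h3 : ‖w‖⁻¹ * inner ℝ a w * ‖w‖⁻¹ = (‖w‖ ^ 2)⁻¹ * inner ℝ a w := by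
    rw [← inv_pow]
    ring
  rw [h3]

/-- Norm form of `sub_inner_smul_unit_eq`: `‖a − ⟪a,e⟫e‖ = (‖w‖²)⁻¹ ‖‖w‖² a − ⟪a,w⟫ w‖` for `e = ‖w‖⁻¹ w`. [folklore] -/
theorem norm_sub_inner_smul_unit_eq {w : EuclideanSpace ℝ (Fin 3)} (hw : w ≠ 0) (a : EuclideanSpace ℝ (Fin 3)) :
    ‖a - inner ℝ a (‖w‖⁻¹ • w) • (‖w‖⁻¹ • w)‖ = (‖w‖ ^ 2)⁻¹ * ‖‖w‖ ^ 2 • a - inner ℝ a w • w‖ := by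
  rw [sub_inner_smul_unit_eq hw a, norm_smul, norm_inv, norm_pow, norm_norm]

/-! ### Far-field reduction in `ξ`-form -/

/-- **`B_rate2_xi` follows from `ξ`-form rate shell locality (registered stub `bRateXi_of_shellRateXi`).** If every
maximal finite-energy classical solution from Clay data admits `C ≥ 0`, `t₀ < T`, `R > 0`, `g₁ ∈ L¹(t₀,T)` with, for all
`M ≥ 1` and all admissible `(t,x,ρ)` with `Mρ ≤ R`, `|⟪D_shell w, w⟫| ≤ (C/M²·Ω(t) + g₁(t))·‖w‖²` (`w = ω(t,x)`), then the
stretching-direction modulus of the re-typed crux holds with the same `C` and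
`g := |g₁| + C_far (√((R/3)⁻⁵) ‖u 0‖₂ + √((R/3)⁻³) ‖∇u(t)‖₂)` — `Registered.farFieldStrain` at a unit vector along `w`,
scaled by `‖w‖²`, exactly as in `Rate.bRate_of_shellRate`. [folklore] -/
theorem bRateXi_of_shellRateXi : (∀ (ν T : ℝ), 0 < ν → 0 < T → ∀ (u : ℝ → EuclideanSpace ℝ (Fin 3) → EuclideanSpace ℝ (Fin 3)) (p : ℝ → EuclideanSpace ℝ (Fin 3) → ℝ), Literature.Analysis.FluidPDE.IsMaximalSmoothSolution ν 0 u p T → Literature.Analysis.FluidPDE.IsLerayHopfOn T ν 0 (u 0) u → Literature.Analysis.FluidPDE.HasRapidSpatialDecay (u 0) → ∃ (C t₀ R : ℝ) (g₁ : ℝ → ℝ), 0 ≤ C ∧ 0 ≤ t₀ ∧ t₀ < T ∧ 0 < R ∧ MeasureTheory.IntegrableOn g₁ (Set.Ico t₀ T) ∧ ∀ (M : ℝ), 1 ≤ M → ∀ t ∈ Set.Ico t₀ T, ∀ (x : EuclideanSpace ℝ (Fin 3)) (ρ : ℝ), 0 < ρ → M * ρ ≤ R → (⨆ z, ‖Literature.Analysis.FluidPDE.curl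 (u t) z‖) ≤ 2 * ‖Literature.Analysis.FluidPDE.curl (u t) x‖ → Metric.ball x ρ ⊆ {y | (⨆ z, ‖Literature.Analysis.FluidPDE.curl (u t) z‖) ≤ 4 * ‖Literature.Analysis.FluidPDE.curl (u t) y‖} → (∀ (x' : EuclideanSpace ℝ (Fin 3)) (ρ' : ℝ), (⨆ z, ‖Literature.Analysis.FluidPDE.curl (u t) z‖) ≤ 2 * ‖Literature.Analysis.FluidPDE.curl (u t) x'‖ → Metric.ball x' ρ' ⊆ {y | (⨆ z, ‖Literature.Analysis.FluidPDE.curl (u t) z‖) ≤ 4 * ‖Literature.Analysis.FluidPDE.curl (u t) y‖} → ρ' ≤ 2 * ρ) → |inner ℝ ((fderiv ℝ (fun z : EuclideanSpace ℝ (Fin 3) => ∫ y, (4 * Real.pi * ‖z - y‖ ^ 3)⁻¹ • Literature.Analysis.FluidPDE.cross ((Metric.ball x R).indicator (Literature.Analysis.FluidPDE.curl (u t)) y) (z - y)) x - fderiv ℝ (fun z : EuclideanSpace ℝ (Fin 3) => ∫ y, (4 * Real.pi * ‖z - y‖ ^ 3)⁻¹ • Literature.Analysis.FluidPDE.cross ((Metric.ball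 x (M * ρ)).indicator (Literature.Analysis.FluidPDE.curl (u t)) y) (z - y)) x) (Literature.Analysis.FluidPDE.curl (u t) x)) (Literature.Analysis.FluidPDE.curl (u t) x)| ≤ (C / M ^ 2 * (⨆ z, ‖Literature.Analysis.FluidPDE.curl (u t) z‖) + g₁ t) * ‖Literature.Analysis.FluidPDE.curl (u t) x‖ ^ 2) → ∀ (ν T : ℝ), 0 < ν → 0 < T → ∀ (u : ℝ → EuclideanSpace ℝ (Fin 3) → EuclideanSpace ℝ (Fin 3)) (p : ℝ → EuclideanSpace ℝ (Fin 3) → ℝ), Literature.Analysis.FluidPDE.IsMaximalSmoothSolution ν 0 u p T → Literature.Analysis.FluidPDE.IsLerayHopfOn T ν 0 (u 0) u → Literature.Analysis.FluidPDE.HasRapidSpatialDecay (u 0) → ∃ (C t₀ : ℝ) (g : ℝ → ℝ), 0 ≤ C ∧ 0 ≤ t₀ ∧ t₀ < T ∧ MeasureTheory.IntegrableOn g (Set.Ico t₀ T) ∧ ∀ (M : ℝ), 1 ≤ M → ∀ t ∈ Set.Ico t₀ T, ∀ (x : EuclideanSpace ℝ (Fin 3)) (ρ : ℝ), 0 < ρ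 → (⨆ z, ‖Literature.Analysis.FluidPDE.curl (u t) z‖) ≤ 2 * ‖Literature.Analysis.FluidPDE.curl (u t) x‖ → Metric.ball x ρ ⊆ {y | (⨆ z, ‖Literature.Analysis.FluidPDE.curl (u t) z‖) ≤ 4 * ‖Literature.Analysis.FluidPDE.curl (u t) y‖} → (∀ (x' : EuclideanSpace ℝ (Fin 3)) (ρ' : ℝ), (⨆ z, ‖Literature.Analysis.FluidPDE.curl (u t) z‖) ≤ 2 * ‖Literature.Analysis.FluidPDE.curl (u t) x'‖ → Metric.ball x' ρ' ⊆ {y | (⨆ z, ‖Literature.Analysis.FluidPDE.curl (u t) z‖) ≤ 4 * ‖Literature.Analysis.FluidPDE.curl (u t) y‖} → ρ' ≤ 2 * ρ) → |inner ℝ ((fderiv ℝ (u t) x - fderiv ℝ (fun z : EuclideanSpace ℝ (Fin 3) => ∫ y, (4 * Real.pi * ‖z - y‖ ^ 3)⁻¹ • Literature.Analysis.FluidPDE.cross ((Metric.ball x (M * ρ)).indicator (Literature.Analysis.FluidPDE.curl (u t)) y) (z - y)) x) (Literature.Analysis.FluidPDE.curl (u t) x)) (Literature.Analysis.FluidPDE.curl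 (u t) x)| ≤ (C / M ^ 2 * (⨆ z, ‖Literature.Analysis.FluidPDE.curl (u t) z‖) + g t) * ‖Literature.Analysis.FluidPDE.curl (u t) x‖ ^ 2 := by
  intro hI ν T hν hT u p hmax hlh hdec
  obtain ⟨C, hC0, hC⟩ := farFieldStrain
  have hcl : Literature.Analysis.FluidPDE.IsClassicalNSSolutionOn (Set.Ico 0 T) ν 0 u p := hmax.1
  obtain ⟨hint, hsq⟩ := stub_enstrophyControl ν T hν hT u p hcl hlh hdec
  obtain ⟨C₁, t₀, R, g₁, hC₁, ht₀, ht₀T, hR, hg₁, hH⟩ := hI ν T hν hT u p hmax hlh hdec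
  obtain ⟨Φ, hΦ⟩ : ∃ Φ : ℝ → ℝ, Φ = fun t => C * (Real.sqrt ((R / 3)⁻¹ ^ 5) * Real.sqrt (∫ y, ‖u 0 y‖ ^ 2) +
      Real.sqrt ((R / 3)⁻¹ ^ 3) * Real.sqrt (∫ y, ‖fderiv ℝ (u t) y‖ ^ 2)) := ⟨_, rfl⟩
  refine ⟨C₁, t₀, fun t => |g₁ t| + Φ t, hC₁, ht₀, ht₀T, ?_, ?_⟩
  · have hsub : Set.Ico t₀ T ⊆ Set.Ico 0 T := Set.Ico_subset_Ico_left ht₀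
    have hN : MeasureTheory.IntegrableOn (fun t => Real.sqrt (∫ y, ‖fderiv ℝ (u t) y‖ ^ 2)) (Set.Ico t₀ T)
        MeasureTheory.volume := hsq.mono_set hsub
    have hΦi : MeasureTheory.IntegrableOn Φ (Set.Ico t₀ T) MeasureTheory.volume := by
      have h1 : MeasureTheory.IntegrableOn (fun _ : ℝ => Real.sqrt ((R / 3)⁻¹ ^ 5) * Real.sqrt (∫ y, ‖u 0 y‖ ^ 2))
          (Set.Ico t₀ T) MeasureTheory.volume := integrableOn_const (by simp)
      rw [hΦ]
      exact ((h1.add (hN.integrable.const_mul _)).integrable.const_mul C)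
    exact hg₁.integrable.abs.add hΦi
  · intro M hM t ht x ρ hρ hpeak hball hmaxrad
    have ht' : t ∈ Set.Ico 0 T := ⟨ht₀.trans ht.1, ht.2⟩
    have hCi : ContDiff ℝ ∞ (u t) := hcl.contDiff_velocity ht'
    have hdiv : Literature.Analysis.FluidPDE.VectorCalculus.IsDivFree (u t) := hcl.divFree t ht'
    have hL2 : MeasureTheory.MemLp (u t) 2 MeasureTheory.volume := hlh.memLp t ⟨ht'.1, ht'.2.le⟩
    have hgrad : MeasureTheory.Integrable (fun y => ‖fderiv ℝ (u t) y‖ ^ 2) MeasureTheory.volume := hint t ht'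
    have hen : Real.sqrt (∫ y, ‖u t y‖ ^ 2) ≤ Real.sqrt (∫ y, ‖u 0 y‖ ^ 2) :=
      Real.sqrt_le_sqrt (farField_integral_norm_sq_le_datum hlh hν.le ⟨ht'.1, ht'.2.le⟩)
    have hΦ0 : 0 ≤ Φ t := by rw [hΦ]; positivity
    -- the far-field bound at any radius `S ≥ R`, for unit vectors, is at most `Φ t`
    have hfarU : ∀ S : ℝ, R ≤ S → ∀ e : EuclideanSpace ℝ (Fin 3), ‖e‖ = 1 →
        |inner ℝ ((fderiv ℝ (u t) x - fderiv ℝ (fun z : EuclideanSpace ℝ (Fin 3) => ∫ y, (4 * Real.pi * ‖z - y‖ ^ 3)⁻¹ • Literature.Analysis.FluidPDE.cross ((Metric.ball x S).indicator (Literature.Analysis.FluidPDE.curl (u t)) y) (z - y)) x) e) e|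
          ≤ Φ t := by
      intro S hRS e he
      have hS : 0 < S := hR.trans_le hRS
      refine (hC (u t) hCi hdiv hL2 hgrad S hS x e he).trans ?_
      have hmono : ∀ k : ℕ, Real.sqrt ((S / 3)⁻¹ ^ k) ≤ Real.sqrt ((R / 3)⁻¹ ^ k) := by
        intro k
        apply Real.sqrt_le_sqrt
        apply pow_le_pow_left₀ (by positivity)
        exact inv_anti₀ (by positivity) (by linarith)
      rw [hΦ]
      have hb0 : 0 ≤ Real.sqrt (∫ y, ‖fderiv ℝ (u t) y‖ ^ 2) := Real.sqrt_nonneg _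
      refine mul_le_mul_of_nonneg_left (add_le_add ?_ ?_) hC0
      · exact mul_le_mul (hmono 5) hen (Real.sqrt_nonneg _) (Real.sqrt_nonneg _)
      · exact mul_le_mul_of_nonneg_right (hmono 3) hb0
    -- scaled to `w = ω(t,x)`
    have hfar : ∀ S : ℝ, R ≤ S →
        |inner ℝ ((fderiv ℝ (u t) x - fderiv ℝ (fun z : EuclideanSpace ℝ (Fin 3) => ∫ y, (4 * Real.pi * ‖z - y‖ ^ 3)⁻¹ • Literature.Analysis.FluidPDE.cross ((Metric.ball x S).indicator (Literature.Analysis.FluidPDE.curl (u t)) y) (z - y)) x) (Literature.Analysis.FluidPDE.curl (u t) x)) (Literature.Analysis.FluidPDE.curl (u t) x)|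
          ≤ Φ t * ‖Literature.Analysis.FluidPDE.curl (u t) x‖ ^ 2 :=
      fun S hRS => abs_inner_apply_self_le_of_unit _ (hfarU S hRS) _
    have hΩ : 0 ≤ C₁ / M ^ 2 * (⨆ z, ‖Literature.Analysis.FluidPDE.curl (u t) z‖) :=
      mul_nonneg (div_nonneg hC₁ (sq_nonneg M)) (iSup_norm_curl_nonneg (u t))
    have hw2 : 0 ≤ ‖Literature.Analysis.FluidPDE.curl (u t) x‖ ^ 2 := sq_nonneg _
    have hg₁abs : g₁ t ≤ |g₁ t| := le_abs_self _
    show _ ≤ (C₁ / M ^ 2 * (⨆ z, ‖Literature.Analysis.FluidPDE.curl (u t) z‖) + (|g₁ t| + Φ t)) * ‖Literature.Analysis.FluidPDE.curl (u t) x‖ ^ 2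
    by_cases hcase : M * ρ ≤ R
    · have h1 := hfar R le_rfl
      have h2 := hH M hM t ht x ρ hρ hcase hpeak hball hmaxrad
      have h12 := add_le_add h1 h2
      refine ((farField_abs_inner_sub_le_split _ _ _ _).trans h12).trans ?_
      nlinarith [mul_le_mul_of_nonneg_right hg₁abs hw2]
    · refine (hfar (M * ρ) (lt_of_not_ge hcase).le).trans ?_
      nlinarith [mul_nonneg hΩ hw2, mul_nonneg (abs_nonneg (g₁ t)) hw2]

/-! ### The `ξ`-form shell statement from the all-directions one, and from direction coherence -/

/-- **All directions ⇒ `ξ`-form** for the shell statement (take `e = w/‖w‖`; both sides vanish when `w = 0`). [folklore] -/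
theorem shellRateXi_of_shellRate : (∀ (ν T : ℝ), 0 < ν → 0 < T → ∀ (u : ℝ → EuclideanSpace ℝ (Fin 3) → EuclideanSpace ℝ (Fin 3)) (p : ℝ → EuclideanSpace ℝ (Fin 3) → ℝ), Literature.Analysis.FluidPDE.IsMaximalSmoothSolution ν 0 u p T → Literature.Analysis.FluidPDE.IsLerayHopfOn T ν 0 (u 0) u → Literature.Analysis.FluidPDE.HasRapidSpatialDecay (u 0) → ∃ (C t₀ R : ℝ) (g₁ : ℝ → ℝ), 0 ≤ C ∧ 0 ≤ t₀ ∧ t₀ < T ∧ 0 < R ∧ MeasureTheory.IntegrableOn g₁ (Set.Ico t₀ T) ∧ ∀ (M : ℝ), 1 ≤ M → ∀ t ∈ Set.Ico t₀ T, ∀ (x : EuclideanSpace ℝ (Fin 3)) (ρ : ℝ), 0 < ρ → M * ρ ≤ R → (⨆ z, ‖Literature.Analysis.FluidPDE.curl (u t) z‖) ≤ 2 * ‖Literature.Analysis.FluidPDE.curl (u t) x‖ → Metric.ball x ρ ⊆ {y | (⨆ z, ‖Literature.Analysis.FluidPDE.curl (u t) z‖) ≤ 4 * ‖Literature.Analysis.FluidPDE.curl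 (u t) y‖} → (∀ (x' : EuclideanSpace ℝ (Fin 3)) (ρ' : ℝ), (⨆ z, ‖Literature.Analysis.FluidPDE.curl (u t) z‖) ≤ 2 * ‖Literature.Analysis.FluidPDE.curl (u t) x'‖ → Metric.ball x' ρ' ⊆ {y | (⨆ z, ‖Literature.Analysis.FluidPDE.curl (u t) z‖) ≤ 4 * ‖Literature.Analysis.FluidPDE.curl (u t) y‖} → ρ' ≤ 2 * ρ) → ∀ e : EuclideanSpace ℝ (Fin 3), ‖e‖ = 1 → |inner ℝ ((fderiv ℝ (fun z : EuclideanSpace ℝ (Fin 3) => ∫ y, (4 * Real.pi * ‖z - y‖ ^ 3)⁻¹ • Literature.Analysis.FluidPDE.cross ((Metric.ball x R).indicator (Literature.Analysis.FluidPDE.curl (u t)) y) (z - y)) x - fderiv ℝ (fun z : EuclideanSpace ℝ (Fin 3) => ∫ y, (4 * Real.pi * ‖z - y‖ ^ 3)⁻¹ • Literature.Analysis.FluidPDE.cross ((Metric.ball x (M * ρ)).indicator (Literature.Analysis.FluidPDE.curl (u t)) y) (z - y)) x) e) e| ≤ C / M ^ 2 * (⨆ z, ‖Literature.Analysis.FluidPDE.curl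 (u t) z‖) + g₁ t) → ∀ (ν T : ℝ), 0 < ν → 0 < T → ∀ (u : ℝ → EuclideanSpace ℝ (Fin 3) → EuclideanSpace ℝ (Fin 3)) (p : ℝ → EuclideanSpace ℝ (Fin 3) → ℝ), Literature.Analysis.FluidPDE.IsMaximalSmoothSolution ν 0 u p T → Literature.Analysis.FluidPDE.IsLerayHopfOn T ν 0 (u 0) u → Literature.Analysis.FluidPDE.HasRapidSpatialDecay (u 0) → ∃ (C t₀ R : ℝ) (g₁ : ℝ → ℝ), 0 ≤ C ∧ 0 ≤ t₀ ∧ t₀ < T ∧ 0 < R ∧ MeasureTheory.IntegrableOn g₁ (Set.Ico t₀ T) ∧ ∀ (M : ℝ), 1 ≤ M → ∀ t ∈ Set.Ico t₀ T, ∀ (x : EuclideanSpace ℝ (Fin 3)) (ρ : ℝ), 0 < ρ → M * ρ ≤ R → (⨆ z, ‖Literature.Analysis.FluidPDE.curl (u t) z‖) ≤ 2 * ‖Literature.Analysis.FluidPDE.curl (u t) x‖ → Metric.ball x ρ ⊆ {y | (⨆ z, ‖Literature.Analysis.FluidPDE.curl (u t) z‖) ≤ 4 * ‖Literature.Analysis.FluidPDE.curl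 (u t) y‖} → (∀ (x' : EuclideanSpace ℝ (Fin 3)) (ρ' : ℝ), (⨆ z, ‖Literature.Analysis.FluidPDE.curl (u t) z‖) ≤ 2 * ‖Literature.Analysis.FluidPDE.curl (u t) x'‖ → Metric.ball x' ρ' ⊆ {y | (⨆ z, ‖Literature.Analysis.FluidPDE.curl (u t) z‖) ≤ 4 * ‖Literature.Analysis.FluidPDE.curl (u t) y‖} → ρ' ≤ 2 * ρ) → |inner ℝ ((fderiv ℝ (fun z : EuclideanSpace ℝ (Fin 3) => ∫ y, (4 * Real.pi * ‖z - y‖ ^ 3)⁻¹ • Literature.Analysis.FluidPDE.cross ((Metric.ball x R).indicator (Literature.Analysis.FluidPDE.curl (u t)) y) (z - y)) x - fderiv ℝ (fun z : EuclideanSpace ℝ (Fin 3) => ∫ y, (4 * Real.pi * ‖z - y‖ ^ 3)⁻¹ • Literature.Analysis.FluidPDE.cross ((Metric.ball x (M * ρ)).indicator (Literature.Analysis.FluidPDE.curl (u t)) y) (z - y)) x) (Literature.Analysis.FluidPDE.curl (u t) x)) (Literature.Analysis.FluidPDE.curl (u t) x)| ≤ (C / M ^ 2 * (⨆ z, ‖Literature.Analysis.FluidPDE.curl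 (u t) z‖) + g₁ t) * ‖Literature.Analysis.FluidPDE.curl (u t) x‖ ^ 2 := by
  intro hS ν T hν hT u p hmax hlh hdec
  obtain ⟨C, t₀, R, g₁, hC, ht₀, ht₀T, hR, hg₁, hH⟩ := hS ν T hν hT u p hmax hlh hdec
  refine ⟨C, t₀, R, g₁, hC, ht₀, ht₀T, hR, hg₁, fun M hM t ht x ρ hρ hMR hpeak hball hmaxrad => ?_⟩
  exact abs_inner_apply_self_le_of_unit _ (hH M hM t ht x ρ hρ hMR hpeak hball hmaxrad) _

/-- **Pointwise coherence relative to `ξ(t,x)` ⇒ `ξ`-form rate shell locality (registered stub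
`shellRateXi_of_shellCoherenceXi`).** If across the shell `B(x,R) ∖ B(x,Mρ)` at admissible peaks
`‖‖w‖² ω(t,y) − ⟪ω(t,y),w⟫ w‖ ≤ c ρ² Ω(t) |x − y|⁻² ‖w‖²` (`w = ω(t,x)`; for `w ≠ 0` this says the component of `ω(t,y)`
orthogonal to `ξ(t,x)` is at most `c ρ² Ω(t)/|x − y|²`), then `ShellRateXi2` holds with `C = C₀ c`, `g₁ = 0`
(`Depletion.shellStretch_abs_le_rate` at `e = ξ(t,x)`, scaled by `‖w‖²`). [folklore] -/
theorem shellRateXi_of_shellCoherenceXi : (∀ (ν T : ℝ), 0 < ν → 0 < T → ∀ (u : ℝ → EuclideanSpace ℝ (Fin 3) → EuclideanSpace ℝ (Fin 3)) (p : ℝ → EuclideanSpace ℝ (Fin 3) → ℝ), Literature.Analysis.FluidPDE.IsMaximalSmoothSolution ν 0 u p T → Literature.Analysis.FluidPDE.IsLerayHopfOn T ν 0 (u 0) u → Literature.Analysis.FluidPDE.HasRapidSpatialDecay (u 0) → ∃ (c t₀ R : ℝ), 0 ≤ c ∧ 0 ≤ t₀ ∧ t₀ < T ∧ 0 < R ∧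 ∀ (M : ℝ), 1 ≤ M → ∀ t ∈ Set.Ico t₀ T, ∀ (x : EuclideanSpace ℝ (Fin 3)) (ρ : ℝ), 0 < ρ → M * ρ ≤ R → (⨆ z, ‖Literature.Analysis.FluidPDE.curl (u t) z‖) ≤ 2 * ‖Literature.Analysis.FluidPDE.curl (u t) x‖ → Metric.ball x ρ ⊆ {y | (⨆ z, ‖Literature.Analysis.FluidPDE.curl (u t) z‖) ≤ 4 * ‖Literature.Analysis.FluidPDE.curl (u t) y‖} → (∀ (x' : EuclideanSpace ℝ (Fin 3)) (ρ' : ℝ), (⨆ z, ‖Literature.Analysis.FluidPDE.curl (u t) z‖) ≤ 2 * ‖Literature.Analysis.FluidPDE.curl (u t) x'‖ → Metric.ball x' ρ' ⊆ {y | (⨆ z, ‖Literature.Analysis.FluidPDE.curl (u t) z‖) ≤ 4 * ‖Literature.Analysis.FluidPDE.curl (u t) y‖} → ρ' ≤ 2 * ρ) → ∀ y ∈ Metric.ball x R \ Metric.ball x (M * ρ), ‖‖Literature.Analysis.FluidPDE.curl (u t) x‖ ^ 2 • Literature.Analysis.FluidPDE.curl (u t) y - inner ℝ (Literature.Analysis.FluidPDE.curl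 (u t) y) (Literature.Analysis.FluidPDE.curl (u t) x) • Literature.Analysis.FluidPDE.curl (u t) x‖ ≤ c * ρ ^ 2 * (⨆ z, ‖Literature.Analysis.FluidPDE.curl (u t) z‖) * (‖x - y‖ ^ 2)⁻¹ * ‖Literature.Analysis.FluidPDE.curl (u t) x‖ ^ 2) → ∀ (ν T : ℝ), 0 < ν → 0 < T → ∀ (u : ℝ → EuclideanSpace ℝ (Fin 3) → EuclideanSpace ℝ (Fin 3)) (p : ℝ → EuclideanSpace ℝ (Fin 3) → ℝ), Literature.Analysis.FluidPDE.IsMaximalSmoothSolution ν 0 u p T → Literature.Analysis.FluidPDE.IsLerayHopfOn T ν 0 (u 0) u → Literature.Analysis.FluidPDE.HasRapidSpatialDecay (u 0) → ∃ (C t₀ R : ℝ) (g₁ : ℝ → ℝ), 0 ≤ C ∧ 0 ≤ t₀ ∧ t₀ < T ∧ 0 < R ∧ MeasureTheory.IntegrableOn g₁ (Set.Ico t₀ T) ∧ ∀ (M : ℝ), 1 ≤ M → ∀ t ∈ Set.Ico t₀ T, ∀ (x : EuclideanSpace ℝ (Fin 3)) (ρ : ℝ), 0 < ρ → M * ρ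 ≤ R → (⨆ z, ‖Literature.Analysis.FluidPDE.curl (u t) z‖) ≤ 2 * ‖Literature.Analysis.FluidPDE.curl (u t) x‖ → Metric.ball x ρ ⊆ {y | (⨆ z, ‖Literature.Analysis.FluidPDE.curl (u t) z‖) ≤ 4 * ‖Literature.Analysis.FluidPDE.curl (u t) y‖} → (∀ (x' : EuclideanSpace ℝ (Fin 3)) (ρ' : ℝ), (⨆ z, ‖Literature.Analysis.FluidPDE.curl (u t) z‖) ≤ 2 * ‖Literature.Analysis.FluidPDE.curl (u t) x'‖ → Metric.ball x' ρ' ⊆ {y | (⨆ z, ‖Literature.Analysis.FluidPDE.curl (u t) z‖) ≤ 4 * ‖Literature.Analysis.FluidPDE.curl (u t) y‖} → ρ' ≤ 2 * ρ) → |inner ℝ ((fderiv ℝ (fun z : EuclideanSpace ℝ (Fin 3) => ∫ y, (4 * Real.pi * ‖z - y‖ ^ 3)⁻¹ • Literature.Analysis.FluidPDE.cross ((Metric.ball x R).indicator (Literature.Analysis.FluidPDE.curl (u t)) y) (z - y)) x - fderiv ℝ (fun z : EuclideanSpace ℝ (Fin 3) => ∫ y, (4 * Real.pi * ‖z - y‖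 ^ 3)⁻¹ • Literature.Analysis.FluidPDE.cross ((Metric.ball x (M * ρ)).indicator (Literature.Analysis.FluidPDE.curl (u t)) y) (z - y)) x) (Literature.Analysis.FluidPDE.curl (u t) x)) (Literature.Analysis.FluidPDE.curl (u t) x)| ≤ (C / M ^ 2 * (⨆ z, ‖Literature.Analysis.FluidPDE.curl (u t) z‖) + g₁ t) * ‖Literature.Analysis.FluidPDE.curl (u t) x‖ ^ 2 := by
  intro hCoh ν T hν hT u p hmax hlh hdec
  obtain ⟨C, hC0, hC⟩ := shellStretch_abs_le_rate
  obtain ⟨c, t₀, R, hc, ht₀, ht₀T, hR, hH⟩ := hCoh ν T hν hT u p hmax hlh hdec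
  refine ⟨C * c, t₀, R, fun _ => 0, mul_nonneg hC0 hc, ht₀, ht₀T, hR, integrableOn_zero, ?_⟩
  intro M hM t ht x ρ hρ hMR hpeak hball hmaxrad
  have ht' : t ∈ Set.Ico 0 T := ⟨ht₀.trans ht.1, ht.2⟩
  have hsm : ContDiff ℝ ∞ (u t) := hmax.1.contDiff_velocity ht'
  have hΩ : 0 ≤ (⨆ z, ‖Literature.Analysis.FluidPDE.curl (u t) z‖) := iSup_norm_curl_nonneg (u t)
  have hM0 : 0 < M := by linarith
  show _ ≤ (C * c / M ^ 2 * (⨆ z, ‖Literature.Analysis.FluidPDE.curl (u t) z‖) + 0) * ‖Literature.Analysis.FluidPDE.curl (u t) x‖ ^ 2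
  rw [add_zero]
  -- name the peak vorticity
  obtain ⟨w, hw⟩ : ∃ w : EuclideanSpace ℝ (Fin 3), w = Literature.Analysis.FluidPDE.curl (u t) x := ⟨_, rfl⟩
  rw [← hw]
  by_cases hw0 : w = 0
  · simp [hw0]
  · have hnw : 0 < ‖w‖ := norm_pos_iff.2 hw0
    obtain ⟨e, he⟩ : ∃ e : EuclideanSpace ℝ (Fin 3), e = ‖w‖⁻¹ • w := ⟨_, rfl⟩
    have hen : ‖e‖ = 1 := by
      rw [he, norm_smul, norm_inv, norm_norm, inv_mul_cancel₀ hnw.ne']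
    -- the coherence hypothesis relative to the unit vector `e`
    have hdec' : ∀ y ∈ Metric.ball x R \ Metric.ball x (M * ρ),
        ‖Literature.Analysis.FluidPDE.curl (u t) y - inner ℝ (Literature.Analysis.FluidPDE.curl (u t) y) e • e‖ ≤
          (c * (⨆ z, ‖Literature.Analysis.FluidPDE.curl (u t) z‖)) * ρ ^ 2 * (‖x - y‖ ^ 2)⁻¹ := by
      intro y hy
      have h := hH M hM t ht x ρ hρ hMR hpeak hball hmaxrad y hy
      rw [← hw] at h
      rw [he, norm_sub_inner_smul_unit_eq hw0]
      have hw2 : 0 < ‖w‖ ^ 2 := pow_pos hnw 2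
      rw [inv_mul_le_iff₀ hw2]
      calc ‖‖w‖ ^ 2 • Literature.Analysis.FluidPDE.curl (u t) y - inner ℝ (Literature.Analysis.FluidPDE.curl (u t) y) w • w‖
          ≤ c * ρ ^ 2 * (⨆ z, ‖Literature.Analysis.FluidPDE.curl (u t) z‖) * (‖x - y‖ ^ 2)⁻¹ * ‖w‖ ^ 2 := h
        _ = ‖w‖ ^ 2 * (c * (⨆ z, ‖Literature.Analysis.FluidPDE.curl (u t) z‖) * ρ ^ 2 * (‖x - y‖ ^ 2)⁻¹) := by ring
    have hb := hC (u t) x ρ M R e (c * (⨆ z, ‖Literature.Analysis.FluidPDE.curl (u t) z‖)) hsm hρ hM0 hMR hen (mul_nonneg hc hΩ) hdec'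
    have hunit : ∀ e' : EuclideanSpace ℝ (Fin 3), ‖e'‖ = 1 → e' = e →
        |inner ℝ ((fderiv ℝ (fun z : EuclideanSpace ℝ (Fin 3) => ∫ y, (4 * Real.pi * ‖z - y‖ ^ 3)⁻¹ • Literature.Analysis.FluidPDE.cross ((Metric.ball x R).indicator (Literature.Analysis.FluidPDE.curl (u t)) y) (z - y)) x - fderiv ℝ (fun z : EuclideanSpace ℝ (Fin 3) => ∫ y, (4 * Real.pi * ‖z - y‖ ^ 3)⁻¹ • Literature.Analysis.FluidPDE.cross ((Metric.ball x (M * ρ)).indicator (Literature.Analysis.FluidPDE.curl (u t)) y) (z - y)) x) e') e'| ≤ C * c / M ^ 2 * (⨆ z, ‖Literature.Analysis.FluidPDE.curl (u t) z‖) := by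
      intro e' _ hee
      rw [hee]
      refine hb.trans_eq ?_
      ring
    have hwe : w = ‖w‖ • e := by
      rw [he, smul_smul, mul_inv_cancel₀ hnw.ne', one_smul]
    calc |inner ℝ ((fderiv ℝ (fun z : EuclideanSpace ℝ (Fin 3) => ∫ y, (4 * Real.pi * ‖z - y‖ ^ 3)⁻¹ • Literature.Analysis.FluidPDE.cross ((Metric.ball x R).indicator (Literature.Analysis.FluidPDE.curl (u t)) y) (z - y)) x - fderiv ℝ (fun z : EuclideanSpace ℝ (Fin 3) => ∫ y, (4 * Real.pi * ‖z - y‖ ^ 3)⁻¹ • Literature.Analysis.FluidPDE.cross ((Metric.ball x (M * ρ)).indicator (Literature.Analysis.FluidPDE.curl (u t)) y) (z - y)) x) w) w|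
        = |inner ℝ ((fderiv ℝ (fun z : EuclideanSpace ℝ (Fin 3) => ∫ y, (4 * Real.pi * ‖z - y‖ ^ 3)⁻¹ • Literature.Analysis.FluidPDE.cross ((Metric.ball x R).indicator (Literature.Analysis.FluidPDE.curl (u t)) y) (z - y)) x - fderiv ℝ (fun z : EuclideanSpace ℝ (Fin 3) => ∫ y, (4 * Real.pi * ‖z - y‖ ^ 3)⁻¹ • Literature.Analysis.FluidPDE.cross ((Metric.ball x (M * ρ)).indicator (Literature.Analysis.FluidPDE.curl (u t)) y) (z - y)) x) (‖w‖ • e)) (‖w‖ • e)| := by rw [← hwe]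
      _ = ‖w‖ ^ 2 * |inner ℝ ((fderiv ℝ (fun z : EuclideanSpace ℝ (Fin 3) => ∫ y, (4 * Real.pi * ‖z - y‖ ^ 3)⁻¹ • Literature.Analysis.FluidPDE.cross ((Metric.ball x R).indicator (Literature.Analysis.FluidPDE.curl (u t)) y) (z - y)) x - fderiv ℝ (fun z : EuclideanSpace ℝ (Fin 3) => ∫ y, (4 * Real.pi * ‖z - y‖ ^ 3)⁻¹ • Literature.Analysis.FluidPDE.cross ((Metric.ball x (M * ρ)).indicator (Literature.Analysis.FluidPDE.curl (u t)) y) (z - y)) x) e) e| := by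
          rw [inner_apply_smul_self, abs_mul, abs_of_nonneg (sq_nonneg _)]
      _ ≤ ‖w‖ ^ 2 * (C * c / M ^ 2 * (⨆ z, ‖Literature.Analysis.FluidPDE.curl (u t) z‖)) :=
          mul_le_mul_of_nonneg_left (hunit e hen rfl) (sq_nonneg _)
      _ = C * c / M ^ 2 * (⨆ z, ‖Literature.Analysis.FluidPDE.curl (u t) z‖) * ‖w‖ ^ 2 := mul_comm _ _

/-- **Depleted integral rate relative to `ξ(t,x)` ⇒ `ξ`-form rate shell locality (registered stub
`shellRateXi_of_depletedShellRateXi`).** A bound `(C/M²·Ω(t) + g₁(t))·‖w‖²` of the division-free depleted shell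
integral `∫_{B(x,R)∖B(x,Mρ)} ‖‖w‖² ω(t,y) − ⟪ω(t,y),w⟫ w‖ |x − y|⁻³ dy` gives `ShellRateXi2` with `(A C, A g₁)`
(`Depletion.shellStretch_abs_le_depleted` at `e = ξ(t,x)`, scaled by `‖w‖²`). [folklore] -/
theorem shellRateXi_of_depletedShellRateXi : (∀ (ν T : ℝ), 0 < ν → 0 < T → ∀ (u : ℝ → EuclideanSpace ℝ (Fin 3) → EuclideanSpace ℝ (Fin 3)) (p : ℝ → EuclideanSpace ℝ (Fin 3) → ℝ), Literature.Analysis.FluidPDE.IsMaximalSmoothSolution ν 0 u p T → Literature.Analysis.FluidPDE.IsLerayHopfOn T ν 0 (u 0) u → Literature.Analysis.FluidPDE.HasRapidSpatialDecay (u 0) → ∃ (C t₀ R : ℝ) (g₁ : ℝ → ℝ), 0 ≤ C ∧ 0 ≤ t₀ ∧ t₀ < T ∧ 0 < R ∧ MeasureTheory.IntegrableOn g₁ (Set.Ico t₀ T) ∧ ∀ (M : ℝ), 1 ≤ M → ∀ t ∈ Set.Ico t₀ T, ∀ (x : EuclideanSpace ℝ (Fin 3)) (ρ : ℝ), 0 <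 ρ → M * ρ ≤ R → (⨆ z, ‖Literature.Analysis.FluidPDE.curl (u t) z‖) ≤ 2 * ‖Literature.Analysis.FluidPDE.curl (u t) x‖ → Metric.ball x ρ ⊆ {y | (⨆ z, ‖Literature.Analysis.FluidPDE.curl (u t) z‖) ≤ 4 * ‖Literature.Analysis.FluidPDE.curl (u t) y‖} → (∀ (x' : EuclideanSpace ℝ (Fin 3)) (ρ' : ℝ), (⨆ z, ‖Literature.Analysis.FluidPDE.curl (u t) z‖) ≤ 2 * ‖Literature.Analysis.FluidPDE.curl (u t) x'‖ → Metric.ball x' ρ' ⊆ {y | (⨆ z, ‖Literature.Analysis.FluidPDE.curl (u t) z‖) ≤ 4 * ‖Literature.Analysis.FluidPDE.curl (u t) y‖} → ρ' ≤ 2 * ρ) → ∫ y in Metric.ball x R \ Metric.ball x (M * ρ), ‖‖Literature.Analysis.FluidPDE.curl (u t) x‖ ^ 2 • Literature.Analysis.FluidPDE.curl (u t) y - inner ℝ (Literature.Analysis.FluidPDE.curl (u t) y) (Literature.Analysis.FluidPDE.curl (u t) x) • Literature.Analysis.FluidPDE.curl (u t) x‖ * (‖x - y‖ ^ 3)⁻¹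 ≤ (C / M ^ 2 * (⨆ z, ‖Literature.Analysis.FluidPDE.curl (u t) z‖) + g₁ t) * ‖Literature.Analysis.FluidPDE.curl (u t) x‖ ^ 2) → ∀ (ν T : ℝ), 0 < ν → 0 < T → ∀ (u : ℝ → EuclideanSpace ℝ (Fin 3) → EuclideanSpace ℝ (Fin 3)) (p : ℝ → EuclideanSpace ℝ (Fin 3) → ℝ), Literature.Analysis.FluidPDE.IsMaximalSmoothSolution ν 0 u p T → Literature.Analysis.FluidPDE.IsLerayHopfOn T ν 0 (u 0) u → Literature.Analysis.FluidPDE.HasRapidSpatialDecay (u 0) → ∃ (C t₀ R : ℝ) (g₁ : ℝ → ℝ), 0 ≤ C ∧ 0 ≤ t₀ ∧ t₀ < T ∧ 0 < R ∧ MeasureTheory.IntegrableOn g₁ (Set.Ico t₀ T) ∧ ∀ (M : ℝ), 1 ≤ M → ∀ t ∈ Set.Ico t₀ T, ∀ (x : EuclideanSpace ℝ (Fin 3)) (ρ : ℝ), 0 < ρ → M * ρ ≤ R → (⨆ z, ‖Literature.Analysis.FluidPDE.curl (u t) z‖) ≤ 2 * ‖Literature.Analysis.FluidPDE.curl (u t)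 x‖ → Metric.ball x ρ ⊆ {y | (⨆ z, ‖Literature.Analysis.FluidPDE.curl (u t) z‖) ≤ 4 * ‖Literature.Analysis.FluidPDE.curl (u t) y‖} → (∀ (x' : EuclideanSpace ℝ (Fin 3)) (ρ' : ℝ), (⨆ z, ‖Literature.Analysis.FluidPDE.curl (u t) z‖) ≤ 2 * ‖Literature.Analysis.FluidPDE.curl (u t) x'‖ → Metric.ball x' ρ' ⊆ {y | (⨆ z, ‖Literature.Analysis.FluidPDE.curl (u t) z‖) ≤ 4 * ‖Literature.Analysis.FluidPDE.curl (u t) y‖} → ρ' ≤ 2 * ρ) → |inner ℝ ((fderiv ℝ (fun z : EuclideanSpace ℝ (Fin 3) => ∫ y, (4 * Real.pi * ‖z - y‖ ^ 3)⁻¹ • Literature.Analysis.FluidPDE.cross ((Metric.ball x R).indicator (Literature.Analysis.FluidPDE.curl (u t)) y) (z - y)) x - fderiv ℝ (fun z : EuclideanSpace ℝ (Fin 3) => ∫ y, (4 * Real.pi * ‖z - y‖ ^ 3)⁻¹ • Literature.Analysis.FluidPDE.cross ((Metric.ball x (M * ρ)).indicator (Literature.Analysis.FluidPDE.curl (u t))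 y) (z - y)) x) (Literature.Analysis.FluidPDE.curl (u t) x)) (Literature.Analysis.FluidPDE.curl (u t) x)| ≤ (C / M ^ 2 * (⨆ z, ‖Literature.Analysis.FluidPDE.curl (u t) z‖) + g₁ t) * ‖Literature.Analysis.FluidPDE.curl (u t) x‖ ^ 2 := by
  intro hD ν T hν hT u p hmax hlh hdec
  obtain ⟨A, hA0, hA⟩ := shellStretch_abs_le_depleted
  obtain ⟨C, t₀, R, g₁, hC, ht₀, ht₀T, hR, hg₁, hH⟩ := hD ν T hν hT u p hmax hlh hdec
  refine ⟨A * C, t₀, R, fun t => A * g₁ t, mul_nonneg hA0 hC, ht₀, ht₀T, hR, hg₁.integrable.const_mul A, ?_⟩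
  intro M hM t ht x ρ hρ hMR hpeak hball hmaxrad
  have ht' : t ∈ Set.Ico 0 T := ⟨ht₀.trans ht.1, ht.2⟩
  have hsm : ContDiff ℝ ∞ (u t) := hmax.1.contDiff_velocity ht'
  have hM0 : 0 < M := by linarith
  have hI := hH M hM t ht x ρ hρ hMR hpeak hball hmaxrad
  show _ ≤ (A * C / M ^ 2 * (⨆ z, ‖Literature.Analysis.FluidPDE.curl (u t) z‖) + A * g₁ t) * ‖Literature.Analysis.FluidPDE.curl (u t) x‖ ^ 2
  obtain ⟨w, hw⟩ : ∃ w : EuclideanSpace ℝ (Fin 3), w = Literature.Analysis.FluidPDE.curl (u t) x := ⟨_, rfl⟩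
  rw [← hw] at hI ⊢
  by_cases hw0 : w = 0
  · simp [hw0]
  · have hnw : 0 < ‖w‖ := norm_pos_iff.2 hw0
    have hw2 : 0 < ‖w‖ ^ 2 := pow_pos hnw 2
    obtain ⟨e, he⟩ : ∃ e : EuclideanSpace ℝ (Fin 3), e = ‖w‖⁻¹ • w := ⟨_, rfl⟩
    have hen : ‖e‖ = 1 := by
      rw [he, norm_smul, norm_inv, norm_norm, inv_mul_cancel₀ hnw.ne']
    have hb := hA (u t) x (M * ρ) R e hsm (mul_pos hM0 hρ) hMR hen
    -- the depleted integral relative to `e` is `(‖w‖²)⁻¹` times the division-free one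
    have hint : ∫ y in Metric.ball x R \ Metric.ball x (M * ρ), ‖Literature.Analysis.FluidPDE.curl (u t) y - inner ℝ (Literature.Analysis.FluidPDE.curl (u t) y) e • e‖ * (‖x - y‖ ^ 3)⁻¹ =
        (‖w‖ ^ 2)⁻¹ * ∫ y in Metric.ball x R \ Metric.ball x (M * ρ), ‖‖w‖ ^ 2 • Literature.Analysis.FluidPDE.curl (u t) y - inner ℝ (Literature.Analysis.FluidPDE.curl (u t) y) (w) • w‖ * (‖x - y‖ ^ 3)⁻¹ := by
      rw [← integral_const_mul]
      refine integral_congr_ae (Eventually.of_forall fun y => ?_)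
      beta_reduce
      rw [he, norm_sub_inner_smul_unit_eq hw0, mul_assoc]
    have hI' : ∫ y in Metric.ball x R \ Metric.ball x (M * ρ), ‖Literature.Analysis.FluidPDE.curl (u t) y - inner ℝ (Literature.Analysis.FluidPDE.curl (u t) y) e • e‖ * (‖x - y‖ ^ 3)⁻¹ ≤
        C / M ^ 2 * (⨆ z, ‖Literature.Analysis.FluidPDE.curl (u t) z‖) + g₁ t := by
      rw [hint, inv_mul_le_iff₀ hw2]
      calc ∫ y in Metric.ball x R \ Metric.ball x (M * ρ), ‖‖w‖ ^ 2 • Literature.Analysis.FluidPDE.curl (u t) y - inner ℝ (Literature.Analysis.FluidPDE.curl (u t) y) (w) • w‖ * (‖x - y‖ ^ 3)⁻¹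
          ≤ (C / M ^ 2 * (⨆ z, ‖Literature.Analysis.FluidPDE.curl (u t) z‖) + g₁ t) * ‖w‖ ^ 2 := hI
        _ = ‖w‖ ^ 2 * (C / M ^ 2 * (⨆ z, ‖Literature.Analysis.FluidPDE.curl (u t) z‖) + g₁ t) := mul_comm _ _
    have hunit : |inner ℝ ((fderiv ℝ (fun z : EuclideanSpace ℝ (Fin 3) => ∫ y, (4 * Real.pi * ‖z - y‖ ^ 3)⁻¹ • Literature.Analysis.FluidPDE.cross ((Metric.ball x R).indicator (Literature.Analysis.FluidPDE.curl (u t)) y) (z - y)) x - fderiv ℝ (fun z : EuclideanSpace ℝ (Fin 3) => ∫ y, (4 * Real.pi * ‖z - y‖ ^ 3)⁻¹ • Literature.Analysis.FluidPDE.cross ((Metric.ball x (M * ρ)).indicator (Literature.Analysis.FluidPDE.curl (u t)) y) (z - y)) x) e) e| ≤ A * C / M ^ 2 * (⨆ z, ‖Literature.Analysis.FluidPDE.curl (u t) z‖) + A * g₁ t := by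
      refine (hb.trans (mul_le_mul_of_nonneg_left hI' hA0)).trans_eq ?_
      ring
    have hwe : w = ‖w‖ • e := by
      rw [he, smul_smul, mul_inv_cancel₀ hnw.ne', one_smul]
    calc |inner ℝ ((fderiv ℝ (fun z : EuclideanSpace ℝ (Fin 3) => ∫ y, (4 * Real.pi * ‖z - y‖ ^ 3)⁻¹ • Literature.Analysis.FluidPDE.cross ((Metric.ball x R).indicator (Literature.Analysis.FluidPDE.curl (u t)) y) (z - y)) x - fderiv ℝ (fun z : EuclideanSpace ℝ (Fin 3) => ∫ y, (4 * Real.pi * ‖z - y‖ ^ 3)⁻¹ • Literature.Analysis.FluidPDE.cross ((Metric.ball x (M * ρ)).indicator (Literature.Analysis.FluidPDE.curl (u t)) y) (z - y)) x) w) w|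
        = |inner ℝ ((fderiv ℝ (fun z : EuclideanSpace ℝ (Fin 3) => ∫ y, (4 * Real.pi * ‖z - y‖ ^ 3)⁻¹ • Literature.Analysis.FluidPDE.cross ((Metric.ball x R).indicator (Literature.Analysis.FluidPDE.curl (u t)) y) (z - y)) x - fderiv ℝ (fun z : EuclideanSpace ℝ (Fin 3) => ∫ y, (4 * Real.pi * ‖z - y‖ ^ 3)⁻¹ • Literature.Analysis.FluidPDE.cross ((Metric.ball x (M * ρ)).indicator (Literature.Analysis.FluidPDE.curl (u t)) y) (z - y)) x) (‖w‖ • e)) (‖w‖ • e)| := by rw [← hwe]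
      _ = ‖w‖ ^ 2 * |inner ℝ ((fderiv ℝ (fun z : EuclideanSpace ℝ (Fin 3) => ∫ y, (4 * Real.pi * ‖z - y‖ ^ 3)⁻¹ • Literature.Analysis.FluidPDE.cross ((Metric.ball x R).indicator (Literature.Analysis.FluidPDE.curl (u t)) y) (z - y)) x - fderiv ℝ (fun z : EuclideanSpace ℝ (Fin 3) => ∫ y, (4 * Real.pi * ‖z - y‖ ^ 3)⁻¹ • Literature.Analysis.FluidPDE.cross ((Metric.ball x (M * ρ)).indicator (Literature.Analysis.FluidPDE.curl (u t)) y) (z - y)) x) e) e| := by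
          rw [inner_apply_smul_self, abs_mul, abs_of_nonneg (sq_nonneg _)]
      _ ≤ ‖w‖ ^ 2 * (A * C / M ^ 2 * (⨆ z, ‖Literature.Analysis.FluidPDE.curl (u t) z‖) + A * g₁ t) := mul_le_mul_of_nonneg_left hunit (sq_nonneg _)
      _ = (A * C / M ^ 2 * (⨆ z, ‖Literature.Analysis.FluidPDE.curl (u t) z‖) + A * g₁ t) * ‖w‖ ^ 2 := mul_comm _ _

/-! ### Compositions: the `ξ`-form of the re-typed crux from shell structure -/

/-- **Pointwise coherence relative to `ξ(t,x)` ⇒ `B_rate2_xi`.** [folklore] -/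
theorem bRateXi_of_shellCoherenceXi : (∀ (ν T : ℝ), 0 < ν → 0 < T → ∀ (u : ℝ → EuclideanSpace ℝ (Fin 3) → EuclideanSpace ℝ (Fin 3)) (p : ℝ → EuclideanSpace ℝ (Fin 3) → ℝ), Literature.Analysis.FluidPDE.IsMaximalSmoothSolution ν 0 u p T → Literature.Analysis.FluidPDE.IsLerayHopfOn T ν 0 (u 0) u → Literature.Analysis.FluidPDE.HasRapidSpatialDecay (u 0) → ∃ (c t₀ R : ℝ), 0 ≤ c ∧ 0 ≤ t₀ ∧ t₀ < T ∧ 0 < R ∧ ∀ (M : ℝ), 1 ≤ M → ∀ t ∈ Set.Ico t₀ T, ∀ (x : EuclideanSpace ℝ (Fin 3)) (ρ : ℝ), 0 < ρ → M * ρ ≤ R → (⨆ z, ‖Literature.Analysis.FluidPDE.curl (u t) z‖) ≤ 2 * ‖Literature.Analysis.FluidPDE.curl (u t) x‖ → Metric.ball x ρ ⊆ {y | (⨆ z, ‖Literature.Analysis.FluidPDE.curl (u t) z‖) ≤ 4 * ‖Literature.Analysis.FluidPDE.curl (u t) y‖} → (∀ (x' : EuclideanSpace ℝ (Fin 3)) (ρ'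 : ℝ), (⨆ z, ‖Literature.Analysis.FluidPDE.curl (u t) z‖) ≤ 2 * ‖Literature.Analysis.FluidPDE.curl (u t) x'‖ → Metric.ball x' ρ' ⊆ {y | (⨆ z, ‖Literature.Analysis.FluidPDE.curl (u t) z‖) ≤ 4 * ‖Literature.Analysis.FluidPDE.curl (u t) y‖} → ρ' ≤ 2 * ρ) → ∀ y ∈ Metric.ball x R \ Metric.ball x (M * ρ), ‖‖Literature.Analysis.FluidPDE.curl (u t) x‖ ^ 2 • Literature.Analysis.FluidPDE.curl (u t) y - inner ℝ (Literature.Analysis.FluidPDE.curl (u t) y) (Literature.Analysis.FluidPDE.curl (u t) x) • Literature.Analysis.FluidPDE.curl (u t) x‖ ≤ c * ρ ^ 2 * (⨆ z, ‖Literature.Analysis.FluidPDE.curl (u t) z‖) * (‖x - y‖ ^ 2)⁻¹ * ‖Literature.Analysis.FluidPDE.curl (u t) x‖ ^ 2) → ∀ (ν T : ℝ), 0 < ν → 0 < T → ∀ (u : ℝ → EuclideanSpace ℝ (Fin 3) → EuclideanSpace ℝ (Fin 3)) (p : ℝ → EuclideanSpace ℝ (Fin 3) → ℝ), Literature.Analysis.FluidPDE.IsMaximalSmoothSolution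 ν 0 u p T → Literature.Analysis.FluidPDE.IsLerayHopfOn T ν 0 (u 0) u → Literature.Analysis.FluidPDE.HasRapidSpatialDecay (u 0) → ∃ (C t₀ : ℝ) (g : ℝ → ℝ), 0 ≤ C ∧ 0 ≤ t₀ ∧ t₀ < T ∧ MeasureTheory.IntegrableOn g (Set.Ico t₀ T) ∧ ∀ (M : ℝ), 1 ≤ M → ∀ t ∈ Set.Ico t₀ T, ∀ (x : EuclideanSpace ℝ (Fin 3)) (ρ : ℝ), 0 < ρ → (⨆ z, ‖Literature.Analysis.FluidPDE.curl (u t) z‖) ≤ 2 * ‖Literature.Analysis.FluidPDE.curl (u t) x‖ → Metric.ball x ρ ⊆ {y | (⨆ z, ‖Literature.Analysis.FluidPDE.curl (u t) z‖) ≤ 4 * ‖Literature.Analysis.FluidPDE.curl (u t) y‖} → (∀ (x' : EuclideanSpace ℝ (Fin 3)) (ρ' : ℝ), (⨆ z, ‖Literature.Analysis.FluidPDE.curl (u t) z‖) ≤ 2 * ‖Literature.Analysis.FluidPDE.curl (u t) x'‖ → Metric.ball x' ρ' ⊆ {y | (⨆ z, ‖Literature.Analysis.FluidPDE.curl (u t)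 z‖) ≤ 4 * ‖Literature.Analysis.FluidPDE.curl (u t) y‖} → ρ' ≤ 2 * ρ) → |inner ℝ ((fderiv ℝ (u t) x - fderiv ℝ (fun z : EuclideanSpace ℝ (Fin 3) => ∫ y, (4 * Real.pi * ‖z - y‖ ^ 3)⁻¹ • Literature.Analysis.FluidPDE.cross ((Metric.ball x (M * ρ)).indicator (Literature.Analysis.FluidPDE.curl (u t)) y) (z - y)) x) (Literature.Analysis.FluidPDE.curl (u t) x)) (Literature.Analysis.FluidPDE.curl (u t) x)| ≤ (C / M ^ 2 * (⨆ z, ‖Literature.Analysis.FluidPDE.curl (u t) z‖) + g t) * ‖Literature.Analysis.FluidPDE.curl (u t) x‖ ^ 2 :=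
  fun h => bRateXi_of_shellRateXi (shellRateXi_of_shellCoherenceXi h)

/-- **Depleted integral rate relative to `ξ(t,x)` ⇒ `B_rate2_xi`.** [folklore] -/
theorem bRateXi_of_depletedShellRateXi : (∀ (ν T : ℝ), 0 < ν → 0 < T → ∀ (u : ℝ → EuclideanSpace ℝ (Fin 3) → EuclideanSpace ℝ (Fin 3)) (p : ℝ → EuclideanSpace ℝ (Fin 3) → ℝ), Literature.Analysis.FluidPDE.IsMaximalSmoothSolution ν 0 u p T → Literature.Analysis.FluidPDE.IsLerayHopfOn T ν 0 (u 0) u → Literature.Analysis.FluidPDE.HasRapidSpatialDecay (u 0) → ∃ (C t₀ R : ℝ) (g₁ : ℝ → ℝ), 0 ≤ C ∧ 0 ≤ t₀ ∧ t₀ < T ∧ 0 < R ∧ MeasureTheory.IntegrableOn g₁ (Set.Ico t₀ T) ∧ ∀ (M : ℝ), 1 ≤ M → ∀ t ∈ Set.Ico t₀ T, ∀ (x : EuclideanSpace ℝ (Fin 3)) (ρ : ℝ), 0 < ρ → M * ρ ≤ R → (⨆ z, ‖Literature.Analysis.FluidPDE.curl (u t) z‖) ≤ 2 * ‖Literature.Analysis.FluidPDE.curl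 (u t) x‖ → Metric.ball x ρ ⊆ {y | (⨆ z, ‖Literature.Analysis.FluidPDE.curl (u t) z‖) ≤ 4 * ‖Literature.Analysis.FluidPDE.curl (u t) y‖} → (∀ (x' : EuclideanSpace ℝ (Fin 3)) (ρ' : ℝ), (⨆ z, ‖Literature.Analysis.FluidPDE.curl (u t) z‖) ≤ 2 * ‖Literature.Analysis.FluidPDE.curl (u t) x'‖ → Metric.ball x' ρ' ⊆ {y | (⨆ z, ‖Literature.Analysis.FluidPDE.curl (u t) z‖) ≤ 4 * ‖Literature.Analysis.FluidPDE.curl (u t) y‖} → ρ' ≤ 2 * ρ) → ∫ y in Metric.ball x R \ Metric.ball x (M * ρ), ‖‖Literature.Analysis.FluidPDE.curl (u t) x‖ ^ 2 • Literature.Analysis.FluidPDE.curl (u t) y - inner ℝ (Literature.Analysis.FluidPDE.curl (u t) y) (Literature.Analysis.FluidPDE.curl (u t) x) • Literature.Analysis.FluidPDE.curl (u t) x‖ * (‖x - y‖ ^ 3)⁻¹ ≤ (C / M ^ 2 * (⨆ z, ‖Literature.Analysis.FluidPDE.curl (u t) z‖) + g₁ t) * ‖Literature.Analysis.FluidPDE.curl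 (u t) x‖ ^ 2) → ∀ (ν T : ℝ), 0 < ν → 0 < T → ∀ (u : ℝ → EuclideanSpace ℝ (Fin 3) → EuclideanSpace ℝ (Fin 3)) (p : ℝ → EuclideanSpace ℝ (Fin 3) → ℝ), Literature.Analysis.FluidPDE.IsMaximalSmoothSolution ν 0 u p T → Literature.Analysis.FluidPDE.IsLerayHopfOn T ν 0 (u 0) u → Literature.Analysis.FluidPDE.HasRapidSpatialDecay (u 0) → ∃ (C t₀ : ℝ) (g : ℝ → ℝ), 0 ≤ C ∧ 0 ≤ t₀ ∧ t₀ < T ∧ MeasureTheory.IntegrableOn g (Set.Ico t₀ T) ∧ ∀ (M : ℝ), 1 ≤ M → ∀ t ∈ Set.Ico t₀ T, ∀ (x : EuclideanSpace ℝ (Fin 3)) (ρ : ℝ), 0 < ρ → (⨆ z, ‖Literature.Analysis.FluidPDE.curl (u t) z‖) ≤ 2 * ‖Literature.Analysis.FluidPDE.curl (u t) x‖ → Metric.ball x ρ ⊆ {y | (⨆ z, ‖Literature.Analysis.FluidPDE.curl (u t) z‖) ≤ 4 * ‖Literature.Analysis.FluidPDE.curl (u t) y‖} → (∀ (x' : EuclideanSpace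 ℝ (Fin 3)) (ρ' : ℝ), (⨆ z, ‖Literature.Analysis.FluidPDE.curl (u t) z‖) ≤ 2 * ‖Literature.Analysis.FluidPDE.curl (u t) x'‖ → Metric.ball x' ρ' ⊆ {y | (⨆ z, ‖Literature.Analysis.FluidPDE.curl (u t) z‖) ≤ 4 * ‖Literature.Analysis.FluidPDE.curl (u t) y‖} → ρ' ≤ 2 * ρ) → |inner ℝ ((fderiv ℝ (u t) x - fderiv ℝ (fun z : EuclideanSpace ℝ (Fin 3) => ∫ y, (4 * Real.pi * ‖z - y‖ ^ 3)⁻¹ • Literature.Analysis.FluidPDE.cross ((Metric.ball x (M * ρ)).indicator (Literature.Analysis.FluidPDE.curl (u t)) y) (z - y)) x) (Literature.Analysis.FluidPDE.curl (u t) x)) (Literature.Analysis.FluidPDE.curl (u t) x)| ≤ (C / M ^ 2 * (⨆ z, ‖Literature.Analysis.FluidPDE.curl (u t) z‖) + g t) * ‖Literature.Analysis.FluidPDE.curl (u t) x‖ ^ 2 :=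
  fun h => bRateXi_of_shellRateXi (shellRateXi_of_depletedShellRateXi h)

end Summit.NavierStokesRegularity.NavierStokesRegularity.Theorems.BlowupIsLocallyDriven.Depletion
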